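import Summits.Langlands.Langlands.Theorems.ExtendedAdequacySplitProduct
import Summits.Langlands.Langlands.Theorems.IrreducibilityBySelfDualityIrreducibleOffSectorTransfer

/-!
# CPR `ExtendedAdequacySplit.CoreIrreducibleProductLifting` (stmt-Langlands-27081), line `birth`, stub 1/5
# `stub_productDescentTransport` (T_Π) — STRUCTURAL REDUCTION to the two functorialities, descent plumbing PROVED

The load-bearing stub of the birth skeleton `Cruxes/CoreIrreducibleProductLifting/Lines/birth.lean` is the PRODUCT DESCENT TRANSPORT
`T_Π : OW → RES → W⁺ → CSD → CPR`: an instance `ρ : Γ_K → GL_n(ℚ̄_ℓ)` of the core-irreducible residual which becomes, over some finite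
solvable Galois `E/K` and in the trace currency, a twisted symmetric square `χ ⊗ Sym² σ` (`n = 3`) or a tensor product `σ₁ ⊗ σ₂` (`n = 4`) of
irreducible geometric rank-2 representations, satisfies `LiftTail` (is weakly automorphic) GIVEN the lineage items OW (28903), RES (28874),
W⁺ (17415), CSD (31695).  The print chain (route docstring, Π1–Π6): Serre_w(E) = OW ∧ RES and the W⁺ avatar LINK the pieces; the instance's
own induction hypothesis `LiftBelow n` at ranks 2 and 1 over `E` makes the pieces weakly automorphic; Gelbart–Jacquet `Sym²` / Ramakrishnan `⊠`
carry the automorphy to (a constituent of) `ρ|_E`; CSD descends `E → K`.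

This file PROVES every step of that chain that is plumbing and isolates the functorial content as TWO DEF-FREE HYPOTHESES, stated in the
tree's weak-automorphy + trace-constituent currency (the currency of CSD / AUT↑ / `BrightMate.SolvablyReducible`):

* `hSym` — **Sym² ⊗ χ CONSTITUENT TRANSPORT** (`GL₂ × GL₁ → GL₃`; Gelbart–Jacquet 1978 Thm (9.3) + (3.7), tree facts
  `GelbartJacquet_symmSq_cuspidal` / `_automorphic`, with the archimedean L-algebraicity of the lift and, for dihedral `σ`, automorphic
  induction of the constituents): if `2·tr r = tr χ · ((tr σ)² + tr σ(g²))` on `Γ_E` with `σ` irreducible geometric of rank 2, `χ` geometric of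
  rank 1, both WEAKLY AUTOMORPHIC over `E`, then SOME irreducible trace-constituent `ϑ` of `r` of positive rank is weakly automorphic over `E`;
* `hTensor` — **⊠ CONSTITUENT TRANSPORT** (`GL₂ × GL₂ → GL₄`; Ramakrishnan 2000 Thm M, tree fact `Ramakrishnan2000_theoremM`, same riders):
  the same for `tr r = tr σ₁ · tr σ₂`.

Everything else is KERNEL-CHECKED here: Serre_w(E) from OW ∧ RES (landed `BrightMate.serre_of_worlds`, the route's dedup decls being the host's
by `Iff.rfl`); the IH `LiftBelow n` at the pieces over `E` with the Serre_w + W⁺ link (`weakAut_of_liftBelow`; ranks `2 < n` and `1 < n` because the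
trace identity forces `n = 3` / `n = 4`, landed `Product.rank_eq_three_of_symSq_shadow` / `rank_eq_four_of_tensor_shadow`; rank-1 irreducibility is
the landed `IrreducibleOffSector.isIrreducible_of_rank_one`); and the descent `E → K` by CSD applied to the automorphic constituent `ϑ` — CSD's
constituent binder is RANK-FREE, so NO irreducibility of `ρ|_E` (no Clifford theory, no Galois-correspondence plumbing) is needed, and the
binders `¬SolvablyReducible`, `¬SolvablyMated` and the image dials of CPR stay idle (`stub_productDescentTransport_of_constituentTransport`).
Hence the EXACT REMAINING LEMMA LIST of T_Π is {`hSym`, `hTensor`} (both PRINT; both Langlands-implied), and CPR itself closes from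
{`hSym`, `hTensor`, OW, RES, W⁺, CSD} (`coreIrreducibleProductLifting_of_constituentTransport`).

§3 records the by-name certificates: T_Π ⟸ CORE (26842, the rev-0 parent: CPR is CORE on a sub-box), ⟸ DEG (28416), ⟸ Langlands, and the
identity with the landed structured support `Product.ProductDescentTransport` (`Iff.rfl`).  No new definition; 0 sorry; standard axioms.
-/

set_option linter.dupNamespace false

namespace Summit.Langlands.Langlands.Theorems.CoreAdequacy.ExtAdequacy.ProductTransport

open Filter IsDedekindDomain NumberField
open scoped MatrixGroups
open Literature.NumberTheory.GaloisRepresentations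
open Literature.NumberTheory.Automorphic
open Literature.NumberTheory.PAdicHodge
open Summit.Langlands.Langlands.Theses
open Summit.Langlands.Langlands.Theorems.BrightMate (serre_of_worlds)
open Summit.Langlands.Langlands.Theorems.IrreducibleOffSector (isIrreducible_of_rank_one)

/-! ## §1 Plumbing: the induction hypothesis at a piece over `E`, linked by Serre_w + W⁺ -/

/-- **IH at a piece.** Modulo Serre_w (`ResidualSplit.ResidualAutomorphy`) and W⁺, the induction hypothesis `LiftBelow n` makes every
irreducible geometric `ϑ : Γ_E → GL_m(ℚ̄_ℓ)` of rank `0 < m < n` over ANY number field `E` weakly automorphic at every level structure: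
Serre_w gives a cuspidal L-algebraic `π₀` congruent to `ϑ`, W⁺ its irreducible avatar `ρ'`, i.e. the LINK antecedent of `LiftTail`, and
`LiftAt m` concludes (the block of the landed `BrightMate.weakAut_of_solvablyReducible`, isolated). -/
theorem weakAut_of_liftBelow (hS : ResidualSplit.ResidualAutomorphy) (hW : OdlyzkoWorldSplit.SatakeAvatarExistence)
    {n : ℕ} (ih : LiftBelow n) {m : ℕ} (hmn : m < n) (hm : 0 < m)
    (E : Type) [Field E] [NumberField E] (hcptE : isCompact_glFiniteIntegralLevel m E)
    (ℓ : ℕ) [Fact ℓ.Prime] (ι : PadicAlgCl ℓ ≃+* ℂ) (ϑ : FramedGaloisRep E (PadicAlgCl ℓ) m)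
    (hirr : ϑ.toGaloisRep.IsIrreducible) (hgeo : LieDefect.Geometric ϑ) :
    ∃ π : CuspidalAutomorphicRepData m E hcptE, π.1.IsLAlgebraic ∧
      ∀ᶠ v : HeightOneSpectrum (𝓞 E) in cofinite, SatakeFrobCompatibleAt ι π.1 ϑ v := by
  obtain ⟨π₀, hLπ₀, hcong⟩ := hS E m hcptE hm ℓ ι ϑ hirr hgeo
  obtain ⟨ρ', hirrρ', hρ'⟩ := hW E m hcptE hm π₀ hLπ₀ ℓ ι
  refine ih m hmn E hcptE hm ℓ ι ϑ hirr hgeo ⟨π₀, ρ', hLπ₀, hirrρ', hρ', ?_⟩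
  filter_upwards [hcong, hρ'] with v ⟨_, _, hall⟩ ⟨α, hα, _, hfrobα⟩
  obtain ⟨P, Q', hP, hQ', hPQ'⟩ := hall α hα
  exact ⟨P, Q', hP, hQ' ▸ hfrobα, hPQ'⟩

/-! ## §2 T_Π from the two constituent transports (Sym² ⊗ χ and ⊠), everything else proved -/

/-- **T_Π ⟸ {Sym² ⊗ χ constituent transport, ⊠ constituent transport}.**  The registered stub `stub_productDescentTransport` of CPR's birth
skeleton — VERBATIM `OdlyzkoWorldAutomorphy → TransOdlyzkoAutomorphy → SatakeAvatarExistence → CliffordSolvableDescent →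
CoreIrreducibleProductLifting` on the route decls — from the two functorialities `GL₂ × GL₁ → GL₃` (Gelbart–Jacquet) and `GL₂ × GL₂ → GL₄`
(Ramakrishnan) in constituent form (`hSym`, `hTensor`, def-free; see the module docstring).  Proof: Serre_w(E) := OW ∧ RES; the Π-witness
gives a solvable Galois `E/K` and a product shadow of `ρ|_E`; its pieces are weakly automorphic over `E` by `weakAut_of_liftBelow` (IH at ranks
2, 1 < n = 3, 4); the hypothesis yields a weakly automorphic irreducible trace-constituent `ϑ` of `ρ|_E`; CSD (any constituent rank) descends to
`K`, which is the conclusion of `LiftTail`.  The dials CycIrr, ¬ADQ, ¬SADQ, ¬D↓, ¬SQAL, `ℓ ≤ n`, ¬SXADQ, CoreIrr, ¬SolvablyReducible,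
¬SolvablyMated and the link hypothesis of `LiftTail` are not used. -/
theorem stub_productDescentTransport_of_constituentTransport
    (hSym : ∀ (E : Type) [Field E] [NumberField E] (n : ℕ) (ℓ : ℕ) [Fact ℓ.Prime] (ι : PadicAlgCl ℓ ≃+* ℂ)
      (r : FramedGaloisRep E (PadicAlgCl ℓ) n) (σ : FramedGaloisRep E (PadicAlgCl ℓ) 2) (χ : FramedGaloisRep E (PadicAlgCl ℓ) 1),
      σ.toGaloisRep.IsIrreducible → LieDefect.Geometric σ → LieDefect.Geometric χ →
      (∀ g : Field.absoluteGaloisGroup E,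
        2 * FramedRep.trace r g = FramedRep.trace χ g * (FramedRep.trace σ g ^ 2 + FramedRep.trace σ (g * g))) →
      (∀ hcpt₂ : isCompact_glFiniteIntegralLevel 2 E, ∃ π : CuspidalAutomorphicRepData 2 E hcpt₂, π.1.IsLAlgebraic ∧
        ∀ᶠ v : HeightOneSpectrum (𝓞 E) in cofinite, SatakeFrobCompatibleAt ι π.1 σ v) →
      (∀ hcpt₁ : isCompact_glFiniteIntegralLevel 1 E, ∃ π : CuspidalAutomorphicRepData 1 E hcpt₁, π.1.IsLAlgebraic ∧
        ∀ᶠ v : HeightOneSpectrum (𝓞 E) in cofinite, SatakeFrobCompatibleAt ι π.1 χ v) →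
      ∃ (m : ℕ) (ϑ : FramedGaloisRep E (PadicAlgCl ℓ) m), 0 < m ∧ ϑ.toGaloisRep.IsIrreducible ∧
        (∃ (mc : ℕ) (θc : FramedGaloisRep E (PadicAlgCl ℓ) mc), ∀ g : Field.absoluteGaloisGroup E,
          FramedRep.trace r g = FramedRep.trace ϑ g + FramedRep.trace θc g) ∧
        ∀ hcptE : isCompact_glFiniteIntegralLevel m E, ∃ π : CuspidalAutomorphicRepData m E hcptE, π.1.IsLAlgebraic ∧
          ∀ᶠ v : HeightOneSpectrum (𝓞 E) in cofinite, SatakeFrobCompatibleAt ι π.1 ϑ v)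
    (hTensor : ∀ (E : Type) [Field E] [NumberField E] (n : ℕ) (ℓ : ℕ) [Fact ℓ.Prime] (ι : PadicAlgCl ℓ ≃+* ℂ)
      (r : FramedGaloisRep E (PadicAlgCl ℓ) n) (σ₁ σ₂ : FramedGaloisRep E (PadicAlgCl ℓ) 2),
      σ₁.toGaloisRep.IsIrreducible → σ₂.toGaloisRep.IsIrreducible → LieDefect.Geometric σ₁ → LieDefect.Geometric σ₂ →
      (∀ g : Field.absoluteGaloisGroup E, FramedRep.trace r g = FramedRep.trace σ₁ g * FramedRep.trace σ₂ g) →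
      (∀ hcpt₂ : isCompact_glFiniteIntegralLevel 2 E, ∃ π : CuspidalAutomorphicRepData 2 E hcpt₂, π.1.IsLAlgebraic ∧
        ∀ᶠ v : HeightOneSpectrum (𝓞 E) in cofinite, SatakeFrobCompatibleAt ι π.1 σ₁ v) →
      (∀ hcpt₂ : isCompact_glFiniteIntegralLevel 2 E, ∃ π : CuspidalAutomorphicRepData 2 E hcpt₂, π.1.IsLAlgebraic ∧
        ∀ᶠ v : HeightOneSpectrum (𝓞 E) in cofinite, SatakeFrobCompatibleAt ι π.1 σ₂ v) →
      ∃ (m : ℕ) (ϑ : FramedGaloisRep E (PadicAlgCl ℓ) m), 0 < m ∧ ϑ.toGaloisRep.IsIrreducible ∧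
        (∃ (mc : ℕ) (θc : FramedGaloisRep E (PadicAlgCl ℓ) mc), ∀ g : Field.absoluteGaloisGroup E,
          FramedRep.trace r g = FramedRep.trace ϑ g + FramedRep.trace θc g) ∧
        ∀ hcptE : isCompact_glFiniteIntegralLevel m E, ∃ π : CuspidalAutomorphicRepData m E hcptE, π.1.IsLAlgebraic ∧
          ∀ᶠ v : HeightOneSpectrum (𝓞 E) in cofinite, SatakeFrobCompatibleAt ι π.1 ϑ v) :
    ExtendedAdequacySplit.OdlyzkoWorldAutomorphy → ExtendedAdequacySplit.TransOdlyzkoAutomorphy →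
      ExtendedAdequacySplit.SatakeAvatarExistence → ExtendedAdequacySplit.CliffordSolvableDescent →
        ExtendedAdequacySplit.CoreIrreducibleProductLifting := by
  intro hOW hRES hW hCSD K _ _ n hcpt hn ih ℓ _ ι ρ _ _ _ _ _ _ _ _ _ hprod _ _ hirr hgeo _
  -- Serre_w from the two world items (the route's dedup decls are the host's, definitionally)
  have hS : ResidualSplit.ResidualAutomorphy := serre_of_worlds hOW hRES
  obtain ⟨E, _, _, _, hGal, hSolv, hshadow⟩ := hprod
  -- a weakly automorphic irreducible trace-constituent of ρ|_E, from the pieces (IH) and the constituent transports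
  obtain ⟨m, ϑ, hm, hϑirr, hϑtr, hϑaut⟩ : ∃ (m : ℕ) (ϑ : FramedGaloisRep E (PadicAlgCl ℓ) m), 0 < m ∧ ϑ.toGaloisRep.IsIrreducible ∧
      (∃ (mc : ℕ) (θc : FramedGaloisRep E (PadicAlgCl ℓ) mc), ∀ g : Field.absoluteGaloisGroup E,
        FramedRep.trace (ρ.restrictField E) g = FramedRep.trace ϑ g + FramedRep.trace θc g) ∧
      ∀ hcptE : isCompact_glFiniteIntegralLevel m E, ∃ π : CuspidalAutomorphicRepData m E hcptE, π.1.IsLAlgebraic ∧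
        ∀ᶠ v : HeightOneSpectrum (𝓞 E) in cofinite, SatakeFrobCompatibleAt ι π.1 ϑ v := by
    rcases hshadow with ⟨σ, χ, hσirr, hσgeo, hχgeo, htr⟩ | ⟨σ₁, σ₂, h₁irr, h₂irr, h₁geo, h₂geo, htr⟩
    · -- twisted symmetric square: n = 3, pieces σ (rank 2) and χ (rank 1) by IH
      have hn3 : n = 3 := ExtAdequacy.Product.rank_eq_three_of_symSq_shadow _ htr
      exact hSym E n ℓ ι (ρ.restrictField E) σ χ hσirr hσgeo hχgeo htr
        (fun hcpt₂ => weakAut_of_liftBelow hS hW ih (by omega) two_pos E hcpt₂ ℓ ι σ hσirr hσgeo)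
        (fun hcpt₁ => weakAut_of_liftBelow hS hW ih (by omega) one_pos E hcpt₁ ℓ ι χ (isIrreducible_of_rank_one χ) hχgeo)
    · -- tensor product: n = 4, pieces σ₁, σ₂ (rank 2) by IH
      have hn4 : n = 4 := ExtAdequacy.Product.rank_eq_four_of_tensor_shadow _ htr
      exact hTensor E n ℓ ι (ρ.restrictField E) σ₁ σ₂ h₁irr h₂irr h₁geo h₂geo htr
        (fun hcpt₂ => weakAut_of_liftBelow hS hW ih (by omega) two_pos E hcpt₂ ℓ ι σ₁ h₁irr h₁geo)
        (fun hcpt₂ => weakAut_of_liftBelow hS hW ih (by omega) two_pos E hcpt₂ ℓ ι σ₂ h₂irr h₂geo)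
  -- Clifford solvable descent E → K from the constituent ϑ (any rank m)
  exact hCSD hW K n ℓ ι ρ hirr hgeo hn E hGal hSolv m ϑ hϑirr hϑtr hm hϑaut hcpt

/-- **CPR ⟸ {Sym² ⊗ χ, ⊠ constituent transports, OW, RES, W⁺, CSD}** — the crux `CoreIrreducibleProductLifting` (route decl, BY NAME) from
the two functorialities and the four lineage items of record (the composition `CoreIrreducibleProductLifting_of` of the skeleton, fed). -/
theorem coreIrreducibleProductLifting_of_constituentTransport
    (hSym : ∀ (E : Type) [Field E] [NumberField E] (n : ℕ) (ℓ : ℕ) [Fact ℓ.Prime] (ι : PadicAlgCl ℓ ≃+* ℂ)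
      (r : FramedGaloisRep E (PadicAlgCl ℓ) n) (σ : FramedGaloisRep E (PadicAlgCl ℓ) 2) (χ : FramedGaloisRep E (PadicAlgCl ℓ) 1),
      σ.toGaloisRep.IsIrreducible → LieDefect.Geometric σ → LieDefect.Geometric χ →
      (∀ g : Field.absoluteGaloisGroup E,
        2 * FramedRep.trace r g = FramedRep.trace χ g * (FramedRep.trace σ g ^ 2 + FramedRep.trace σ (g * g))) →
      (∀ hcpt₂ : isCompact_glFiniteIntegralLevel 2 E, ∃ π : CuspidalAutomorphicRepData 2 E hcpt₂, π.1.IsLAlgebraic ∧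
        ∀ᶠ v : HeightOneSpectrum (𝓞 E) in cofinite, SatakeFrobCompatibleAt ι π.1 σ v) →
      (∀ hcpt₁ : isCompact_glFiniteIntegralLevel 1 E, ∃ π : CuspidalAutomorphicRepData 1 E hcpt₁, π.1.IsLAlgebraic ∧
        ∀ᶠ v : HeightOneSpectrum (𝓞 E) in cofinite, SatakeFrobCompatibleAt ι π.1 χ v) →
      ∃ (m : ℕ) (ϑ : FramedGaloisRep E (PadicAlgCl ℓ) m), 0 < m ∧ ϑ.toGaloisRep.IsIrreducible ∧
        (∃ (mc : ℕ) (θc : FramedGaloisRep E (PadicAlgCl ℓ) mc), ∀ g : Field.absoluteGaloisGroup E,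
          FramedRep.trace r g = FramedRep.trace ϑ g + FramedRep.trace θc g) ∧
        ∀ hcptE : isCompact_glFiniteIntegralLevel m E, ∃ π : CuspidalAutomorphicRepData m E hcptE, π.1.IsLAlgebraic ∧
          ∀ᶠ v : HeightOneSpectrum (𝓞 E) in cofinite, SatakeFrobCompatibleAt ι π.1 ϑ v)
    (hTensor : ∀ (E : Type) [Field E] [NumberField E] (n : ℕ) (ℓ : ℕ) [Fact ℓ.Prime] (ι : PadicAlgCl ℓ ≃+* ℂ)
      (r : FramedGaloisRep E (PadicAlgCl ℓ) n) (σ₁ σ₂ : FramedGaloisRep E (PadicAlgCl ℓ) 2),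
      σ₁.toGaloisRep.IsIrreducible → σ₂.toGaloisRep.IsIrreducible → LieDefect.Geometric σ₁ → LieDefect.Geometric σ₂ →
      (∀ g : Field.absoluteGaloisGroup E, FramedRep.trace r g = FramedRep.trace σ₁ g * FramedRep.trace σ₂ g) →
      (∀ hcpt₂ : isCompact_glFiniteIntegralLevel 2 E, ∃ π : CuspidalAutomorphicRepData 2 E hcpt₂, π.1.IsLAlgebraic ∧
        ∀ᶠ v : HeightOneSpectrum (𝓞 E) in cofinite, SatakeFrobCompatibleAt ι π.1 σ₁ v) →
      (∀ hcpt₂ : isCompact_glFiniteIntegralLevel 2 E, ∃ π : CuspidalAutomorphicRepData 2 E hcpt₂, π.1.IsLAlgebraic ∧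
        ∀ᶠ v : HeightOneSpectrum (𝓞 E) in cofinite, SatakeFrobCompatibleAt ι π.1 σ₂ v) →
      ∃ (m : ℕ) (ϑ : FramedGaloisRep E (PadicAlgCl ℓ) m), 0 < m ∧ ϑ.toGaloisRep.IsIrreducible ∧
        (∃ (mc : ℕ) (θc : FramedGaloisRep E (PadicAlgCl ℓ) mc), ∀ g : Field.absoluteGaloisGroup E,
          FramedRep.trace r g = FramedRep.trace ϑ g + FramedRep.trace θc g) ∧
        ∀ hcptE : isCompact_glFiniteIntegralLevel m E, ∃ π : CuspidalAutomorphicRepData m E hcptE, π.1.IsLAlgebraic ∧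
          ∀ᶠ v : HeightOneSpectrum (𝓞 E) in cofinite, SatakeFrobCompatibleAt ι π.1 ϑ v)
    (hOW : ExtendedAdequacySplit.OdlyzkoWorldAutomorphy) (hRES : ExtendedAdequacySplit.TransOdlyzkoAutomorphy)
    (hW : ExtendedAdequacySplit.SatakeAvatarExistence) (hCSD : ExtendedAdequacySplit.CliffordSolvableDescent) :
    ExtendedAdequacySplit.CoreIrreducibleProductLifting :=
  stub_productDescentTransport_of_constituentTransport hSym hTensor hOW hRES hW hCSD

/-! ## §3 Certificates by name: T_Π ⟸ CORE (26842) / DEG (28416) / Langlands; identity with the structured support -/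

/-- The registered stub IS the landed structured support `Product.ProductDescentTransport` (definitionally: the route's CPR text and the
structured cell agree by `Iff.rfl`, as recorded by the landed `Product.pi_clause_iff` and the dial clause identities). -/
theorem stub_productDescentTransport_iff_twin :
    (ExtendedAdequacySplit.OdlyzkoWorldAutomorphy → ExtendedAdequacySplit.TransOdlyzkoAutomorphy →
      ExtendedAdequacySplit.SatakeAvatarExistence → ExtendedAdequacySplit.CliffordSolvableDescent →
        ExtendedAdequacySplit.CoreIrreducibleProductLifting) ↔ ExtAdequacy.Product.ProductDescentTransport :=
  Iff.rfl

/-- **T_Π ⟸ CORE.** CPR is the rev-0 residual CORE `ExtendedAdequacySplit.CoreIrreducibleInadequateLifting` (stmt-Langlands-26842, the split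
parent) on the sub-box Π (landed `Product.core_route_iff_product_cells`), so its transport holds outright given CORE. -/
theorem stub_productDescentTransport_of_core (h : ExtendedAdequacySplit.CoreIrreducibleInadequateLifting) :
    ExtendedAdequacySplit.OdlyzkoWorldAutomorphy → ExtendedAdequacySplit.TransOdlyzkoAutomorphy →
      ExtendedAdequacySplit.SatakeAvatarExistence → ExtendedAdequacySplit.CliffordSolvableDescent →
        ExtendedAdequacySplit.CoreIrreducibleProductLifting :=
  fun _ _ _ _ => (ExtAdequacy.Product.core_route_iff_product_cells.mp h).1

/-- **T_Π ⟸ DEG** (the grandparent route decl `LieDefectSplit.DegenerateLayerLifting`, stmt-Langlands-28416; landed `Product.Cert.productTransport_of_deg`, read through `stub_productDescentTransport_iff_twin`). -/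
theorem stub_productDescentTransport_of_deg (h : LieDefectSplit.DegenerateLayerLifting) :
    ExtendedAdequacySplit.OdlyzkoWorldAutomorphy → ExtendedAdequacySplit.TransOdlyzkoAutomorphy →
      ExtendedAdequacySplit.SatakeAvatarExistence → ExtendedAdequacySplit.CliffordSolvableDescent →
        ExtendedAdequacySplit.CoreIrreducibleProductLifting :=
  stub_productDescentTransport_iff_twin.mpr (ExtAdequacy.Product.Cert.productTransport_of_deg h)

/-- **T_Π ⟸ Langlands** (necessity certificate: the stub is summit-implied; landed `Product.Cert.cpr_of_langlands`). -/
theorem stub_productDescentTransport_of_langlands (hL : _root_.Langlands) :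
    ExtendedAdequacySplit.OdlyzkoWorldAutomorphy → ExtendedAdequacySplit.TransOdlyzkoAutomorphy →
      ExtendedAdequacySplit.SatakeAvatarExistence → ExtendedAdequacySplit.CliffordSolvableDescent →
        ExtendedAdequacySplit.CoreIrreducibleProductLifting :=
  fun _ _ _ _ => ExtAdequacy.Product.Cert.cpr_of_langlands hL

end Summit.Langlands.Langlands.Theorems.CoreAdequacy.ExtAdequacy.ProductTransport
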